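import Mathlib
import Literature.Analysis.FluidPDE.WeakGradientIBP
import HarnessLib

/-!
# Crux E `PowerGaugeEulerLiouville` (stmt-NavierStokesRegularity-19832), line `galilean-frames` (ns-idea-11 g6), stub F1e
# `stub_frameSteadyEscaping` — tools I: THE FRAME SHEAR, FRAME INTEGRANDS, INTEGRATION BY PARTS IN TIME (width seat ns-ezl-w3 g5)

Route №10 `EulerZoomLiouville` (NavierStokesRegularity), crux E.  Measure-theoretic tools for the distributional bookkeeping of a
FRAME-STEADY member `u(τ, y) = U(y − ξ(τ))` of Seregin's class (line `galilean-frames`, lever (L2)):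

* `measurableEmbedding_frameShear`, `measurePreserving_frameShear` — the shear `(τ, y) ↦ (τ, y − ξ(τ))` is a measure-preserving automorphism of space–time
  (`MeasurePreserving.skew_product`: every slice is a translation);
* `setIntegral_slab_frame_eq` — slab integrals of `F(τ, y − ξ(τ))` are iterated frame integrals `∫ (∫ F(τ, z) dz) dτ` (shear + Fubini);
* `integrable_frame_linear`, `integrable_frame_quadratic` — integrability on `ℝ × ℝ³` of the frame integrands `χ(τ)⟪U(z), G(z + ξ(τ))⟫`
  (`U ∈ L¹_loc`) and `χ(τ)⟪U(z), Ψ(z + ξ(τ)) U(z)⟫` (`|U|² ∈ L¹_loc`) for compactly supported continuous `χ`, `G`, `Ψ`;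
* `integrable_inner_comp_add`, `integrable_inner_clm_comp_add_self` — the corresponding slice integrands;
* `eq_of_integral_deriv_mul_add_eq_zero` — BY PARTS + FUNDAMENTAL LEMMA: if `f ∈ C¹(ℝ)` with `f' = g`, `N` continuous and
  `∫ (χ' f + χ N) = 0` for every smooth `χ` compactly supported in `(−∞, T₁)`, then `N = g` on `(−∞, T₁)`.

WHAT THIS IS NOT: not NS regularity, not the crux E — tools for one stratum of the crux CLASS 19832 (MODEL lattice; E/NS strata),
`--supports` stmt-19832; 19832 OPEN. [folklore]
-/

noncomputable section

-- flat `Theorems/<Route><Decl>…` files of one crux share the namespace of the crux (tree convention: `Summit.<S>.<S>.…`)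
set_option linter.dupNamespace false

open MeasureTheory Set Filter Topology Metric Function TopologicalSpace InnerProductSpace
open scoped ENNReal NNReal RealInnerProductSpace ContDiff

namespace Summit.NavierStokesRegularity.NavierStokesRegularity.Theorems.PowerGaugeEulerLiouville

namespace GalileanFrames

open Literature.Analysis Literature.Analysis.FunctionSpaces Literature.Analysis.FluidPDE
open Summit.NavierStokesRegularity.NavierStokesRegularity.Theorems.PowerGaugeEulerLiouville

variable {U : EuclideanSpace ℝ (Fin 3) → EuclideanSpace ℝ (Fin 3)} {ξ : ℝ → EuclideanSpace ℝ (Fin 3)}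

/-! ### The frame shear `(τ, y) ↦ (τ, y − ξ(τ))` -/

/-- The frame shear `(τ, y) ↦ (τ, y − ξ(τ))` is a measurable embedding of space–time into itself (it is a measurable automorphism with
inverse `(τ, z) ↦ (τ, z + ξ(τ))`; `ξ` measurable). [folklore] -/
theorem measurableEmbedding_frameShear (hξ : Measurable ξ) :
    MeasurableEmbedding (fun z : ℝ × EuclideanSpace ℝ (Fin 3) => (z.1, z.2 - ξ z.1)) :=
  let e : ℝ × EuclideanSpace ℝ (Fin 3) ≃ᵐ ℝ × EuclideanSpace ℝ (Fin 3) :=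
    { toFun := fun z => (z.1, z.2 - ξ z.1)
      invFun := fun z => (z.1, z.2 + ξ z.1)
      left_inv := fun z => by simp
      right_inv := fun z => by simp
      measurable_toFun := measurable_fst.prodMk (measurable_snd.sub (hξ.comp measurable_fst))
      measurable_invFun := measurable_fst.prodMk (measurable_snd.add (hξ.comp measurable_fst)) }
  e.measurableEmbedding

/-- **The frame shear preserves space–time Lebesgue measure** (each slice is a translation; `MeasurePreserving.skew_product`). [folklore] -/
theorem measurePreserving_frameShear (hξ : Measurable ξ) :
    MeasurePreserving (fun z : ℝ × EuclideanSpace ℝ (Fin 3) => (z.1, z.2 - ξ z.1))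
      ((volume : Measure ℝ).prod (volume : Measure (EuclideanSpace ℝ (Fin 3))))
      ((volume : Measure ℝ).prod (volume : Measure (EuclideanSpace ℝ (Fin 3)))) := by
  have h := MeasurePreserving.skew_product (μa := (volume : Measure ℝ)) (μb := (volume : Measure ℝ))
    (μc := (volume : Measure (EuclideanSpace ℝ (Fin 3)))) (μd := (volume : Measure (EuclideanSpace ℝ (Fin 3))))
    (f := id) (MeasurePreserving.id volume) (g := fun τ y => y - ξ τ)
    (measurable_snd.sub (hξ.comp measurable_fst))
    (Eventually.of_forall fun τ => (measurePreserving_sub_right volume (ξ τ)).map_eq)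
  simpa using h

/-- **Slab integrals in the moving frame.**  For an integrable frame integrand `F(τ, z)` vanishing for `τ ≥ 0`,
`∫∫_{(−∞,0)×ℝ³} F(τ, y − ξ(τ)) = ∫ (∫ F(τ, z) dz) dτ` (frame shear + Fubini). [folklore] -/
theorem setIntegral_slab_frame_eq (hξ : Measurable ξ) {F : ℝ → EuclideanSpace ℝ (Fin 3) → ℝ}
    (hF0 : ∀ τ : ℝ, 0 ≤ τ → ∀ z, F τ z = 0)
    (hFi : Integrable (uncurry F) ((volume : Measure ℝ).prod (volume : Measure (EuclideanSpace ℝ (Fin 3))))) :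
    ∫ z in Iio (0 : ℝ) ×ˢ (univ : Set (EuclideanSpace ℝ (Fin 3))), F z.1 (z.2 - ξ z.1) = ∫ τ, ∫ z, F τ z := by
  have h1 : ∫ z in Iio (0 : ℝ) ×ˢ (univ : Set (EuclideanSpace ℝ (Fin 3))), F z.1 (z.2 - ξ z.1) =
      ∫ z : ℝ × EuclideanSpace ℝ (Fin 3), F z.1 (z.2 - ξ z.1) := by
    refine setIntegral_eq_integral_of_forall_compl_eq_zero fun z hz => ?_
    have hz' : ¬ z.1 < 0 := fun h => hz ⟨h, mem_univ _⟩
    exact hF0 z.1 (not_lt.1 hz') _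
  have h2 : ∫ z : ℝ × EuclideanSpace ℝ (Fin 3), F z.1 (z.2 - ξ z.1) =
      ∫ z : ℝ × EuclideanSpace ℝ (Fin 3), uncurry F z ∂((volume : Measure ℝ).prod volume) := by
    rw [Measure.volume_eq_prod]
    exact (measurePreserving_frameShear hξ).integral_comp (measurableEmbedding_frameShear hξ) (uncurry F)
  rw [h1, h2, integral_prod _ hFi]
  rfl

/-! ### Integrability of the frame integrands -/

/-- A continuous compactly supported real function of time is bounded and supported in a compact interval. [folklore] -/
theorem exists_bound_Icc_of_hasCompactSupport {χ : ℝ → ℝ} (hχ : Continuous χ) (hχc : HasCompactSupport χ) :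
    ∃ T C : ℝ, 0 ≤ C ∧ (∀ τ, ‖χ τ‖ ≤ C) ∧ ∀ τ, χ τ ≠ 0 → τ ∈ Icc (-T) T := by
  obtain ⟨C, hC⟩ := hχ.bounded_above_of_compact_support hχc
  obtain ⟨T, hT⟩ := hχc.isCompact.isBounded.subset_closedBall (0 : ℝ)
  refine ⟨T, C, (norm_nonneg _).trans (hC 0), hC, fun τ hτ => ?_⟩
  have h := hT (subset_tsupport _ (mem_support.2 hτ))
  rw [mem_closedBall, dist_zero_right, Real.norm_eq_abs, abs_le] at h
  exact h

/-- **Integrability of the linear frame integrand** `(τ, z) ↦ χ(τ) ⟪U(z), G(z + ξ(τ))⟫` (`U ∈ L¹_loc`, `G` continuous with compact support,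
`χ` continuous with compact support, `ξ` continuous). [folklore] -/
theorem integrable_frame_linear (hU : LocallyIntegrable U volume) (hξ : Continuous ξ)
    {χ : ℝ → ℝ} (hχ : Continuous χ) (hχc : HasCompactSupport χ)
    {G : EuclideanSpace ℝ (Fin 3) → EuclideanSpace ℝ (Fin 3)} (hG : Continuous G) (hGc : HasCompactSupport G) :
    Integrable (uncurry fun τ z => χ τ * ⟪U z, G (z + ξ τ)⟫)
      ((volume : Measure ℝ).prod (volume : Measure (EuclideanSpace ℝ (Fin 3)))) := by
  obtain ⟨T, Cχ, hCχ0, hCχ, hχT⟩ := exists_bound_Icc_of_hasCompactSupport hχ hχc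
  obtain ⟨CG, hCG⟩ := hG.bounded_above_of_compact_support hGc
  have hCG0 : 0 ≤ CG := (norm_nonneg _).trans (hCG 0)
  obtain ⟨R₀, hR₀⟩ := hGc.isCompact.isBounded.subset_closedBall (0 : EuclideanSpace ℝ (Fin 3))
  obtain ⟨M, hM⟩ := (isCompact_Icc (a := -T) (b := T)).exists_bound_of_continuousOn hξ.continuousOn
  set K : Set (EuclideanSpace ℝ (Fin 3)) := closedBall 0 (R₀ + M) with hK
  have hKc : IsCompact K := isCompact_closedBall _ _
  -- the dominating function
  set bound : ℝ × EuclideanSpace ℝ (Fin 3) → ℝ := fun p =>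
    (Icc (-T) T).indicator (fun _ => Cχ) p.1 * K.indicator (fun z => CG * ‖U z‖) p.2 with hbound
  have hbi : Integrable bound ((volume : Measure ℝ).prod (volume : Measure (EuclideanSpace ℝ (Fin 3)))) := by
    refine Integrable.mul_prod ?_ ?_
    · rw [integrable_indicator_iff measurableSet_Icc]
      exact integrableOn_const (by rw [Real.volume_Icc]; exact ENNReal.ofReal_ne_top)
    · rw [integrable_indicator_iff hKc.measurableSet]
      exact ((hU.integrableOn_isCompact hKc).norm.const_mul CG)
  have hmeas : AEStronglyMeasurable (uncurry fun τ z => χ τ * ⟪U z, G (z + ξ τ)⟫)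
      ((volume : Measure ℝ).prod (volume : Measure (EuclideanSpace ℝ (Fin 3)))) := by
    have h1 : AEStronglyMeasurable (fun p : ℝ × EuclideanSpace ℝ (Fin 3) => U p.2)
        ((volume : Measure ℝ).prod (volume : Measure (EuclideanSpace ℝ (Fin 3)))) := hU.aestronglyMeasurable.comp_snd
    have h2 : Continuous fun p : ℝ × EuclideanSpace ℝ (Fin 3) => G (p.2 + ξ p.1) :=
      hG.comp (continuous_snd.add (hξ.comp continuous_fst))
    exact ((hχ.comp continuous_fst).aestronglyMeasurable).mul (h1.inner h2.aestronglyMeasurable)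
  refine hbi.mono' hmeas (Eventually.of_forall fun p => ?_)
  simp only [uncurry, hbound]
  by_cases hτ : χ p.1 = 0
  · rw [hτ, zero_mul, norm_zero]
    exact mul_nonneg (indicator_nonneg (fun _ _ => hCχ0) _)
      (indicator_nonneg (fun z _ => mul_nonneg hCG0 (norm_nonneg _)) _)
  have hτI : p.1 ∈ Icc (-T) T := hχT p.1 hτ
  rw [indicator_of_mem hτI]
  by_cases hz : p.2 ∈ K
  · rw [indicator_of_mem hz, norm_mul]
    refine mul_le_mul (hCχ _) ?_ (norm_nonneg _) hCχ0
    calc ‖⟪U p.2, G (p.2 + ξ p.1)⟫‖ ≤ ‖U p.2‖ * ‖G (p.2 + ξ p.1)‖ := norm_inner_le_norm _ _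
      _ ≤ ‖U p.2‖ * CG := by gcongr; exact hCG _
      _ = CG * ‖U p.2‖ := mul_comm _ _
  · -- off `K` the shifted point misses the support of `G`
    have hG0 : G (p.2 + ξ p.1) = 0 := by
      by_contra hne
      have h1 : ‖p.2 + ξ p.1‖ ≤ R₀ := mem_closedBall_zero_iff.1 (hR₀ (subset_tsupport _ (mem_support.2 hne)))
      have h2 : ‖p.2‖ ≤ ‖p.2 + ξ p.1‖ + ‖ξ p.1‖ := norm_le_add_norm_add p.2 (ξ p.1)
      exact hz (mem_closedBall_zero_iff.2 (by linarith [hM p.1 hτI]))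
    rw [hG0, inner_zero_right, mul_zero, norm_zero, indicator_of_notMem hz, mul_zero]

/-- **Integrability of the quadratic frame integrand** `(τ, z) ↦ χ(τ) ⟪U(z), Ψ(z + ξ(τ)) U(z)⟫` (`|U|² ∈ L¹_loc`, `Ψ` a continuous compactly
supported operator field, `χ` continuous with compact support, `ξ` continuous). [folklore] -/
theorem integrable_frame_quadratic (hUm : AEStronglyMeasurable U volume)
    (hU2 : LocallyIntegrable (fun z => ‖U z‖ ^ 2) volume) (hξ : Continuous ξ)
    {χ : ℝ → ℝ} (hχ : Continuous χ) (hχc : HasCompactSupport χ)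
    {Ψ : EuclideanSpace ℝ (Fin 3) → EuclideanSpace ℝ (Fin 3) →L[ℝ] EuclideanSpace ℝ (Fin 3)} (hΨ : Continuous Ψ)
    (hΨc : HasCompactSupport Ψ) :
    Integrable (uncurry fun τ z => χ τ * ⟪U z, Ψ (z + ξ τ) (U z)⟫)
      ((volume : Measure ℝ).prod (volume : Measure (EuclideanSpace ℝ (Fin 3)))) := by
  obtain ⟨T, Cχ, hCχ0, hCχ, hχT⟩ := exists_bound_Icc_of_hasCompactSupport hχ hχc
  obtain ⟨CΨ, hCΨ⟩ := hΨ.bounded_above_of_compact_support hΨc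
  have hCΨ0 : 0 ≤ CΨ := (norm_nonneg _).trans (hCΨ 0)
  obtain ⟨R₀, hR₀⟩ := hΨc.isCompact.isBounded.subset_closedBall (0 : EuclideanSpace ℝ (Fin 3))
  obtain ⟨M, hM⟩ := (isCompact_Icc (a := -T) (b := T)).exists_bound_of_continuousOn hξ.continuousOn
  set K : Set (EuclideanSpace ℝ (Fin 3)) := closedBall 0 (R₀ + M) with hK
  have hKc : IsCompact K := isCompact_closedBall _ _
  set bound : ℝ × EuclideanSpace ℝ (Fin 3) → ℝ := fun p =>
    (Icc (-T) T).indicator (fun _ => Cχ) p.1 * K.indicator (fun z => CΨ * ‖U z‖ ^ 2) p.2 with hbound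
  have hbi : Integrable bound ((volume : Measure ℝ).prod (volume : Measure (EuclideanSpace ℝ (Fin 3)))) := by
    refine Integrable.mul_prod ?_ ?_
    · rw [integrable_indicator_iff measurableSet_Icc]
      exact integrableOn_const (by rw [Real.volume_Icc]; exact ENNReal.ofReal_ne_top)
    · rw [integrable_indicator_iff hKc.measurableSet]
      exact ((hU2.integrableOn_isCompact hKc).const_mul CΨ)
  have hmeas : AEStronglyMeasurable (uncurry fun τ z => χ τ * ⟪U z, Ψ (z + ξ τ) (U z)⟫)
      ((volume : Measure ℝ).prod (volume : Measure (EuclideanSpace ℝ (Fin 3)))) := by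
    have h1 : AEStronglyMeasurable (fun p : ℝ × EuclideanSpace ℝ (Fin 3) => U p.2)
        ((volume : Measure ℝ).prod (volume : Measure (EuclideanSpace ℝ (Fin 3)))) := hUm.comp_snd
    have h2 : Continuous fun p : ℝ × EuclideanSpace ℝ (Fin 3) => Ψ (p.2 + ξ p.1) :=
      hΨ.comp (continuous_snd.add (hξ.comp continuous_fst))
    have h3 : AEStronglyMeasurable (fun p : ℝ × EuclideanSpace ℝ (Fin 3) => Ψ (p.2 + ξ p.1) (U p.2))
        ((volume : Measure ℝ).prod (volume : Measure (EuclideanSpace ℝ (Fin 3)))) :=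
      (isBoundedBilinearMap_apply (𝕜 := ℝ) (E := EuclideanSpace ℝ (Fin 3)) (F := EuclideanSpace ℝ (Fin 3))).continuous
        |>.comp_aestronglyMeasurable (h2.aestronglyMeasurable.prodMk h1)
    exact ((hχ.comp continuous_fst).aestronglyMeasurable).mul (h1.inner h3)
  refine hbi.mono' hmeas (Eventually.of_forall fun p => ?_)
  simp only [uncurry, hbound]
  by_cases hτ : χ p.1 = 0
  · rw [hτ, zero_mul, norm_zero]
    exact mul_nonneg (indicator_nonneg (fun _ _ => hCχ0) _)
      (indicator_nonneg (fun z _ => mul_nonneg hCΨ0 (sq_nonneg _)) _)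
  have hτI : p.1 ∈ Icc (-T) T := hχT p.1 hτ
  rw [indicator_of_mem hτI]
  by_cases hz : p.2 ∈ K
  · rw [indicator_of_mem hz, norm_mul]
    refine mul_le_mul (hCχ _) ?_ (norm_nonneg _) hCχ0
    calc ‖⟪U p.2, Ψ (p.2 + ξ p.1) (U p.2)⟫‖ ≤ ‖U p.2‖ * ‖Ψ (p.2 + ξ p.1) (U p.2)‖ := norm_inner_le_norm _ _
      _ ≤ ‖U p.2‖ * (CΨ * ‖U p.2‖) := by
          gcongr
          exact (ContinuousLinearMap.le_opNorm _ _).trans (mul_le_mul_of_nonneg_right (hCΨ _) (norm_nonneg _))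
      _ = CΨ * ‖U p.2‖ ^ 2 := by ring
  · have hΨ0 : Ψ (p.2 + ξ p.1) = 0 := by
      by_contra hne
      have h1 : ‖p.2 + ξ p.1‖ ≤ R₀ := mem_closedBall_zero_iff.1 (hR₀ (subset_tsupport _ (mem_support.2 hne)))
      have h2 : ‖p.2‖ ≤ ‖p.2 + ξ p.1‖ + ‖ξ p.1‖ := norm_le_add_norm_add p.2 (ξ p.1)
      exact hz (mem_closedBall_zero_iff.2 (by linarith [hM p.1 hτI]))
    rw [hΨ0, zero_apply, inner_zero_right, mul_zero, norm_zero, indicator_of_notMem hz, mul_zero]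

/-! ### Slice integrability -/

/-- `z ↦ ⟪U z, G(z + w)⟫` is integrable for `U ∈ L¹_loc` and `G` continuous with compact support. [folklore] -/
theorem integrable_inner_comp_add (hU : LocallyIntegrable U volume)
    {G : EuclideanSpace ℝ (Fin 3) → EuclideanSpace ℝ (Fin 3)} (hG : Continuous G) (hGc : HasCompactSupport G)
    (w : EuclideanSpace ℝ (Fin 3)) : Integrable (fun z => ⟪U z, G (z + w)⟫) volume := by
  refine integrable_inner_of_locallyIntegrable_of_hasCompactSupport hU (hG.comp (continuous_id.add continuous_const)) ?_
  have h := hGc.comp_homeomorph (Homeomorph.addRight w)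
  exact h

/-- `z ↦ ⟪U z, Ψ(z + w) U z⟫` is integrable for `|U|² ∈ L¹_loc` and `Ψ` a continuous compactly supported operator field. [folklore] -/
theorem integrable_inner_clm_comp_add_self (hUm : AEStronglyMeasurable U volume)
    (hU2 : LocallyIntegrable (fun z => ‖U z‖ ^ 2) volume)
    {Ψ : EuclideanSpace ℝ (Fin 3) → EuclideanSpace ℝ (Fin 3) →L[ℝ] EuclideanSpace ℝ (Fin 3)} (hΨ : Continuous Ψ)
    (hΨc : HasCompactSupport Ψ) (w : EuclideanSpace ℝ (Fin 3)) :
    Integrable (fun z => ⟪U z, Ψ (z + w) (U z)⟫) volume := by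
  obtain ⟨M₁, hM₁⟩ := hΨ.bounded_above_of_compact_support hΨc
  have hK : IsCompact (tsupport fun z => Ψ (z + w)) := (hΨc.comp_homeomorph (Homeomorph.addRight w))
  set K := tsupport fun z => Ψ (z + w)
  have hmeas : AEStronglyMeasurable (fun z => ⟪U z, Ψ (z + w) (U z)⟫) volume :=
    hUm.inner ((isBoundedBilinearMap_apply (𝕜 := ℝ) (E := EuclideanSpace ℝ (Fin 3))
      (F := EuclideanSpace ℝ (Fin 3))).continuous.comp_aestronglyMeasurable
        ((hΨ.comp (continuous_id.add continuous_const)).aestronglyMeasurable.prodMk hUm))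
  have hg : Integrable (fun z => M₁ * ‖K.indicator (fun z => ‖U z‖ ^ 2) z‖) volume :=
    ((integrable_indicator_iff hK.measurableSet).2 (hU2.integrableOn_isCompact hK)).norm.const_mul M₁
  refine hg.mono' hmeas (Eventually.of_forall fun z => ?_)
  by_cases hz : z ∈ K
  · rw [indicator_of_mem hz, Real.norm_of_nonneg (sq_nonneg ‖U z‖)]
    calc ‖⟪U z, Ψ (z + w) (U z)⟫‖ ≤ ‖U z‖ * ‖Ψ (z + w) (U z)‖ := norm_inner_le_norm _ _
      _ ≤ ‖U z‖ * (M₁ * ‖U z‖) := by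
          gcongr
          exact (ContinuousLinearMap.le_opNorm _ _).trans (mul_le_mul_of_nonneg_right (hM₁ _) (norm_nonneg _))
      _ = M₁ * ‖U z‖ ^ 2 := by ring
  · have h0 : (fun z => Ψ (z + w)) z = 0 := image_eq_zero_of_notMem_tsupport (f := fun z => Ψ (z + w)) hz
    simp only at h0
    rw [h0, indicator_of_notMem hz]
    simp

/-! ### Integration by parts in time and the fundamental lemma -/

/-- **By parts + fundamental lemma of the calculus of variations.**  If `f` is `C¹` on `ℝ` with continuous derivative `g`, `N` is
continuous, and `∫ (χ' f + χ N) = 0` for every smooth `χ` compactly supported in `(−∞, T₁)`, then `N = g` on `(−∞, T₁)`. [folklore] -/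
theorem eq_of_integral_deriv_mul_add_eq_zero {f g N : ℝ → ℝ} {T₁ : ℝ}
    (hf : ∀ τ, HasDerivAt f (g τ) τ) (hg : Continuous g) (hN : Continuous N)
    (h : ∀ χ : ℝ → ℝ, ContDiff ℝ (⊤ : ℕ∞) χ → HasCompactSupport χ → tsupport χ ⊆ Iio T₁ →
      ∫ τ, (deriv χ τ * f τ + χ τ * N τ) = 0)
    {τ : ℝ} (hτ : τ < T₁) : N τ = g τ := by
  have hfc : Continuous f := continuous_iff_continuousAt.2 fun t => (hf t).continuousAt
  -- by parts: `∫ χ' f = −∫ χ g`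
  have hparts : ∀ χ : ℝ → ℝ, ContDiff ℝ (⊤ : ℕ∞) χ → HasCompactSupport χ →
      ∫ t, deriv χ t * f t = -∫ t, χ t * g t := by
    intro χ hχ hχc
    have hχd : ∀ x, HasDerivAt χ (deriv χ x) x := fun x => ((hχ.differentiable (by simp)) x).hasDerivAt
    have hχ'c : Continuous (deriv χ) := hχ.continuous_deriv (by simp)
    have hχ's : HasCompactSupport (deriv χ) := hχc.deriv
    have i1 : Integrable (χ * g) volume := (hχ.continuous.mul hg).integrable_of_hasCompactSupport hχc.mul_right
    have i2 : Integrable (deriv χ * f) volume := (hχ'c.mul hfc).integrable_of_hasCompactSupport hχ's.mul_right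
    obtain ⟨T, -, -, -, hχT⟩ := exists_bound_Icc_of_hasCompactSupport hχ.continuous hχc
    have hzero : ∀ t, t ∉ Icc (-T) T → (χ * f) t = 0 := fun t ht => by
      have : χ t = 0 := by by_contra hne; exact ht (hχT t hne)
      simp [this]
    have hbot : Tendsto (χ * f) atBot (𝓝 0) := by
      refine tendsto_const_nhds.congr' ?_
      filter_upwards [eventually_lt_atBot (-T)] with t ht
      exact (hzero t fun h => (not_le.2 ht) h.1).symm
    have htop : Tendsto (χ * f) atTop (𝓝 0) := by
      refine tendsto_const_nhds.congr' ?_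
      filter_upwards [eventually_gt_atTop T] with t ht
      exact (hzero t fun h => (not_le.2 ht) h.2).symm
    have hip := integral_mul_deriv_eq_deriv_mul (fun x _ => hχd x) (fun x _ => hf x) i1 i2 hbot htop
    rw [sub_self, zero_sub] at hip
    rw [hip, neg_neg]
  -- hence `∫ χ (N − g) = 0` for every admissible `χ`
  have hzero : ∀ χ : ℝ → ℝ, ContDiff ℝ (⊤ : ℕ∞) χ → HasCompactSupport χ → tsupport χ ⊆ Iio T₁ →
      ∫ t, χ t • (N t - g t) = 0 := by
    intro χ hχ hχc hχT
    have e := h χ hχ hχc hχT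
    have hχ'c : Continuous (deriv χ) := hχ.continuous_deriv (by simp)
    have i2 : Integrable (fun t => deriv χ t * f t) volume :=
      (hχ'c.mul hfc).integrable_of_hasCompactSupport hχc.deriv.mul_right
    have iN : Integrable (fun t => χ t * N t) volume := (hχ.continuous.mul hN).integrable_of_hasCompactSupport hχc.mul_right
    have ig : Integrable (fun t => χ t * g t) volume := (hχ.continuous.mul hg).integrable_of_hasCompactSupport hχc.mul_right
    rw [integral_add i2 iN, hparts χ hχ hχc] at e
    have e2 : ∫ t, χ t • (N t - g t) = (∫ t, χ t * N t) - ∫ t, χ t * g t := by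
      rw [← integral_sub iN ig]
      refine integral_congr_ae (Eventually.of_forall fun t => ?_)
      simp only [smul_eq_mul]; ring
    rw [e2]; linarith
  -- fundamental lemma on the open set `(−∞, T₁)`, then continuity
  have hae := IsOpen.ae_eq_zero_of_integral_contDiff_smul_eq_zero isOpen_Iio
    ((hN.sub hg).locallyIntegrable.locallyIntegrableOn (Iio T₁)) hzero
  have hEq : EqOn (fun t => N t - g t) (fun _ => (0 : ℝ)) (Iio T₁) :=
    Measure.eqOn_open_of_ae_eq ((ae_restrict_iff' measurableSet_Iio).2 hae) isOpen_Iio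
      (hN.sub hg).continuousOn continuousOn_const
  exact sub_eq_zero.1 (hEq hτ)


end GalileanFrames

end Summit.NavierStokesRegularity.NavierStokesRegularity.Theorems.PowerGaugeEulerLiouville
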